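import Summits.CriticalPhenomena.Ising3DConformalLimit.Theses.HelsonAxis
import Literature.Probability.LatticeModels.CriticalTwoPointLawDimension
import Literature.Probability.LatticeModels.HighDimPointwiseTriviality
import HarnessLib

/-!
# Crux `AxialHelsonCone` (item stmt-CriticalPhenomena-18121) — which guards of the order-2 Helson cone are
# load-bearing (refuter birth vetting, 2026-08-17)

THEOREM-ONLY negative lemmas (no definition, no named fact, no `sorry`, no positive route-item conclusion).
Write `g(n) = ⟨σ₀σ_{n e₀}⟩⁺_{β_c(3)}` (`criticalTwoPoint 3 (Pi.single 0 n)`). The crux reads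
`∃ ℓ₀ > 0, ∀ N ≥ ℓ₀, ∀ b ≥ 1, g(Nb)² ≤ g(N)·g(Nb²)`.

* `axialHelsonCone_minor_at_one` : at `b = 1` the 2×2 Helson minor vanishes identically (the instance is an
  equality), so the content of the crux starts at `b ≥ 2`.
* `axialHelsonCone_minor_at_zero_left` : at `N = 0` the minor vanishes identically too, so the guard `0 < ℓ₀`
  is cosmetic (the statement with `ℓ₀ = 0` allowed is equivalent).
* `axialHelsonCone_false_without_one_le_b` : the guard `1 ≤ b` IS load-bearing — with `b = 0` admitted the
  minor at `(N, 0)` reads `g(0)² ≤ g(N)·g(0)`, i.e. `1 ≤ g(N)`, which fails for every large `N` because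
  `g(N e₀) → 0` (infrared bound, tree theorem `criticalTwoPoint_tendsto_zero_cofinite`).

References: J. Fröhlich, B. Simon, T. Spencer, Comm. Math. Phys. 50 (1976) 79 (infrared bound) and B. Simon,
Comm. Math. Phys. 77 (1980) 111 — together the tree fact `criticalTwoPoint_bounds_holds` behind
`criticalTwoPoint_tendsto_zero_cofinite`.
-/

open Filter
open scoped Topology
open Literature.Probability.LatticeModels

namespace Summit.CriticalPhenomena.Ising3DConformalLimit.AxialHelsonConeNegative

/-- At `b = 1` the 2×2 Helson minor of the crux is identically zero: the instance holds with equality.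
[folklore] -/
theorem axialHelsonCone_minor_at_one (N : ℕ) :
    criticalTwoPoint 3 (Pi.single (0 : Fin 3) ((N * 1 : ℕ) : ℤ)) ^ 2 =
      criticalTwoPoint 3 (Pi.single (0 : Fin 3) ((N : ℕ) : ℤ)) *
        criticalTwoPoint 3 (Pi.single (0 : Fin 3) ((N * 1 ^ 2 : ℕ) : ℤ)) := by
  simp [sq]

/-- At `N = 0` the 2×2 Helson minor is identically zero as well (so the guard `0 < ℓ₀` is cosmetic).
[folklore] -/
theorem axialHelsonCone_minor_at_zero_left (b : ℕ) :
    criticalTwoPoint 3 (Pi.single (0 : Fin 3) ((0 * b : ℕ) : ℤ)) ^ 2 =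
      criticalTwoPoint 3 (Pi.single (0 : Fin 3) ((0 : ℕ) : ℤ)) *
        criticalTwoPoint 3 (Pi.single (0 : Fin 3) ((0 * b ^ 2 : ℕ) : ℤ)) := by
  simp [sq]

/-- Along a lattice axis the critical two-point function of `ℤ³` is eventually `< 1`
(it tends to `0` by the infrared bound). [folklore] -/
theorem criticalTwoPoint_axis_eventually_lt_one :
    ∀ᶠ k : ℕ in atTop, criticalTwoPoint 3 (Pi.single (0 : Fin 3) (k : ℤ)) < 1 := by
  have hinj : Function.Injective (fun k : ℕ => (Pi.single (0 : Fin 3) (k : ℤ) : Site 3)) := by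
    intro a b h
    have := congrFun h 0
    simp at this
    exact_mod_cast this
  have h := criticalTwoPoint_tendsto_zero_cofinite.comp
    (Nat.cofinite_eq_atTop ▸ hinj.tendsto_cofinite)
  exact h.eventually (gt_mem_nhds one_pos)

/-- **The guard `1 ≤ b` of `AxialHelsonCone` is load-bearing.** The crux with `1 ≤ b` dropped,
`∃ ℓ₀ > 0, ∀ N ≥ ℓ₀, ∀ b, g(Nb)² ≤ g(N)·g(Nb²)`, is FALSE: at `b = 0` it says `1 = g(0)² ≤ g(N)·g(0) = g(N)`,
while `g(N e₀) < 1` for all large `N`. [folklore] -/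
theorem axialHelsonCone_false_without_one_le_b :
    ¬ (∃ ℓ₀ : ℕ, 0 < ℓ₀ ∧ ∀ N b : ℕ, ℓ₀ ≤ N →
        criticalTwoPoint 3 (Pi.single (0 : Fin 3) ((N * b : ℕ) : ℤ)) ^ 2 ≤
          criticalTwoPoint 3 (Pi.single (0 : Fin 3) ((N : ℕ) : ℤ)) *
            criticalTwoPoint 3 (Pi.single (0 : Fin 3) ((N * b ^ 2 : ℕ) : ℤ))) := by
  rintro ⟨ℓ₀, -, h⟩
  obtain ⟨k, hk⟩ :=
    (criticalTwoPoint_axis_eventually_lt_one.and (eventually_ge_atTop ℓ₀)).exists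
  have h0 := h k 0 hk.2
  simp [criticalTwoPoint_zero'] at h0
  linarith [hk.1]

end Summit.CriticalPhenomena.Ising3DConformalLimit.AxialHelsonConeNegative
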